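import Summits.AtomisticToContinuum.Crystallization.Theorems.ThreeConeCertificateSlackRigidityPricedFloorsFinal1
import Summits.AtomisticToContinuum.Crystallization.Theorems.ThreeConeCertificateSlackRigidityPricedFloorsFinal2
import Summits.AtomisticToContinuum.Crystallization.Theorems.ThreeConeCertificateSlackRigidityPricedFloorsFinal3
import HarnessLib

/-!
# `SlackRigidity` (stmt-AtomisticToContinuum-11960), line `priced-floors-palm-exactification`:
# STUB S3 `stub_layeredMeanSelection` — CLOSED

Lead c19.  **Selection in mean.**  A minimising point-stationary law of rooted `δ`-hard-core
configurations that is almost surely carried by globally exactly layered sets is almost surely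
carried by optimal hcp samples: almost every sample is a fitted set (`lms_ae_fitted`); the priced
stacking-fault functional vanishes a.s. by the layer transport + registry price + window bound, so the
stacking word alternates (`lms_ae_faultfree`); the symmetric spacing-jump functional vanishes a.s. by
the layer transports + convexity of the window energies in the spacings, so all spacings agree
(`lms_ae_equal_spacing`); such samples are rotated `hcp(a,h)` crystals with `h ≥ e*`, pinned to `e*`
by `E[h] ≤ e*`, hence optimal (`lms_optimal_of_ae`).  `[folklore]` assembly of the landed parts.
-/

noncomputable section

open MeasureTheory Filter Set
open scoped ENNReal BigOperators

namespace Summit.AtomisticToContinuum.Crystallization.Theorems.SlackRigidityPricedFloorsFinal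

open Literature.Probability.Process
open Literature.MathematicalPhysics.StatisticalMechanics
open Summit.AtomisticToContinuum.Crystallization.Theorems.SlackRigidityPricedFloors

/-- **Stub S3 of the line (`stub_layeredMeanSelection`, registered): selection in mean.** [folklore] -/
theorem stub_layeredMeanSelection : ∀ δ : ℝ, 0 < δ → ∀ P : Measure (Measure E3), IsProbabilityMeasure P → IsMinimisingLaw δ P → (∀ᵐ μ ∂P, GlobalLayered (atoms μ)) → ∀ᵐ μ ∂P, IsOptimalHcpSample μ := by
  intro δ hδ P hP hlaw hGL
  have hff := lms_ae_faultfree δ hδ P hP hlaw hGL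
  exact lms_optimal_of_ae δ hδ P hP hlaw (lms_ae_fitted δ P hlaw.1 hGL) hff
    (lms_ae_equal_spacing δ hδ P hP hlaw hGL hff)

end Summit.AtomisticToContinuum.Crystallization.Theorems.SlackRigidityPricedFloorsFinal

end
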